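import Summits.QuantumAdvantage.QuantumAdvantage.Theses.YangBaxterIslands
import Literature.Computability.Complexity.CircuitLowerBoundsIW

/-!
# Line `derandomization_split` for crux `YbTarget` (stmt-QuantumAdvantage-2545) — strategist (cstrat r1)

Skeleton of the DECOMPOSITION of the deciding crux along the derandomization seam:

  stub_eHard  (E needs 2^{εn}-size circuits a.e. — the Impagliazzo–Wigderson hypothesis, circuit complexity)
  stub_notP   (some XXZBQP language is outside P — the thesis with BPP ↦ P, strictly weaker than the crux)
  ─────────────────────────────────────────────────────────────── YbTarget_of (seam = IW97 Thm 2, PROVED in the tree: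
  YbTarget    (some XXZBQP language is outside BPP)                 `impagliazzo_wigderson_holds : stub_eHard-statement → P = BPP`)

The two stubs are the proposed route children `YbEHard`, `YbNotP` (Cruxes/YbTarget/Split.lean, children.json);
the composition below is byte-identical in content to `Split.YbTarget_of_subs`. Card: Lines/derandomization-split.md.
-/

namespace Summit.QuantumAdvantage.QuantumAdvantage.Cruxes.YbTarget.DerandomizationSplit

open Summit.QuantumAdvantage.QuantumAdvantage.Theses.YangBaxterIslands

/-- STUB 1 `stub_eHard` (hypothesis-type crux; circuit complexity): some language in `E = DTIME(2^{O(n)})` has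
circuit complexity `≥ 2^{εn}` at all large `n`. Verbatim the antecedent of the tree's named fact
`Literature.Computability.Complexity.impagliazzo_wigderson` (pnp.S24). Believed (Impagliazzo–Wigderson 1997;
Arora–Barak Thm 20.7); no proof technique in sight (exponential circuit lower bounds for E; natural-proofs and
relativization/algebrization barriers bear on it); refuters/grounders, not provers. -/
theorem stub_eHard : ∃ L ∈ Literature.Computability.Complexity.E, ∃ ε : ℝ, 0 < ε ∧ ∀ᶠ n : ℕ in Filter.atTop, (2 : ℝ) ^ (ε * n) ≤ (L.circuitSize n : ℝ) := by
  sorry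

/-- STUB 2 `stub_notP` (crux; the integrable brickwork beats deterministic polynomial time): some language decided
by a rational-angle homogeneous Yang–Baxter-integrable XXZ brickwork family (class XXZBQP, inlined as in the route
file) is not in `P`. A CONSEQUENCE of the crux (`Split.notP_of_target`, via `P ⊆ BPP`), strictly weaker than it
(the converse is `BPP ⊆ P`); foreseen proof shape `YbHardness ∧ (BQP ⊄ P)` (`Split.notP_of_hardness_of_bqpNotP`);
refutation surface: a DETERMINISTIC island `XXZBQP ⊆ P` (free line b ∈ ½ℤ and trivial lines a ∈ ½ℤ ∪ ¼+½ℤ are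
already ⊆ P: route supports YbFreeFermionLine / YbTrivialLines). -/
theorem stub_notP : ∃ L : Language Bool, (∃ a b : ℚ, ∃ (f : List Bool → List Bool) (p q : Polynomial ℕ), f ∈ Literature.Computability.Complexity.FP ∧ ∃ F : Literature.Computability.Cryptography.QCircuitFamily (⟨Unit, fun _ => 2, fun _ => Matrix.of fun u v : Fin 2 → Bool => if u 0 = u 1 then (if v = u then Complex.exp (-((((b : ℝ) * Real.pi) : ℝ) : ℂ) * Complex.I) else 0) else if v 0 = v 1 then 0 else Complex.exp (((((b : ℝ) * Real.pi) : ℝ) : ℂ) * Complex.I) * (if v = u then ((Real.cos (2 * ((a : ℝ) * Real.pi)) : ℝ) : ℂ) else -(Complex.I * ((Real.sin (2 * ((a : ℝ) * Real.pi)) : ℝ) : ℂ)))⟩ : Literature.Computability.Cryptography.QGateSet), F = ⟨fun n => p.eval n, fun n => ⟨(List.range (q.eval n)).flatMap fun s => (List.range (n + p.eval n)).filterMap fun j => if h : j % 2 = s % 2 ∧ j + 1 < (n + p.eval n) then some (Literature.Computability.Cryptography.QGate.gate () ⟨fun i : Fin 2 => ⟨j + i.val, by have := i.isLt; omega⟩,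 fun i i' hh => Fin.ext (by simp only [Fin.mk.injEq] at hh; omega)⟩) else none⟩⟩ ∧ ∀ x : List Bool, (x ∈ L → (2 : ℝ) / 3 ≤ F.acceptProbOn 0 (f x)) ∧ (x ∉ L → F.acceptProbOn 0 (f x) ≤ 1 / 3)) ∧ L ∉ Literature.Computability.Complexity.Classes.P := by
  sorry

/-- COMPOSITION (kernel-checked, no sorry): the two stubs give the crux BY NAME. The seam is the tree's proved
Impagliazzo–Wigderson theorem (`impagliazzo_wigderson_holds`, Literature/Computability/Complexity/CircuitLowerBoundsIW.lean):
`stub_eHard` ⟹ `P = BPP`, whence the XXZBQP witness outside `P` is outside `BPP`. -/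
theorem YbTarget_of :
    (∃ L ∈ Literature.Computability.Complexity.E, ∃ ε : ℝ, 0 < ε ∧ ∀ᶠ n : ℕ in Filter.atTop, (2 : ℝ) ^ (ε * n) ≤ (L.circuitSize n : ℝ)) →
    (∃ L : Language Bool, (∃ a b : ℚ, ∃ (f : List Bool → List Bool) (p q : Polynomial ℕ), f ∈ Literature.Computability.Complexity.FP ∧ ∃ F : Literature.Computability.Cryptography.QCircuitFamily (⟨Unit, fun _ => 2, fun _ => Matrix.of fun u v : Fin 2 → Bool => if u 0 = u 1 then (if v = u then Complex.exp (-((((b : ℝ) * Real.pi) : ℝ) : ℂ) * Complex.I) else 0) else if v 0 = v 1 then 0 else Complex.exp (((((b : ℝ) * Real.pi) : ℝ) : ℂ) * Complex.I) * (if v = u then ((Real.cos (2 * ((a : ℝ) * Real.pi)) : ℝ) : ℂ) else -(Complex.I * ((Real.sin (2 * ((a : ℝ) * Real.pi)) : ℝ) : ℂ)))⟩ : Literature.Computability.Cryptography.QGateSet), F = ⟨fun n => p.eval n, fun n => ⟨(List.range (q.eval n)).flatMap fun s => (List.range (n + p.eval n)).filterMap fun j => if h : j % 2 = s % 2 ∧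 j + 1 < (n + p.eval n) then some (Literature.Computability.Cryptography.QGate.gate () ⟨fun i : Fin 2 => ⟨j + i.val, by have := i.isLt; omega⟩, fun i i' hh => Fin.ext (by simp only [Fin.mk.injEq] at hh; omega)⟩) else none⟩⟩ ∧ ∀ x : List Bool, (x ∈ L → (2 : ℝ) / 3 ≤ F.acceptProbOn 0 (f x)) ∧ (x ∉ L → F.acceptProbOn 0 (f x) ≤ 1 / 3)) ∧ L ∉ Literature.Computability.Complexity.Classes.P) →
    YbTarget := by
  intro hE hX
  -- Impagliazzo–Wigderson 1997, Thm. 2: hardness of E derandomises BPP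
  have hPBPP : Literature.Computability.Complexity.Classes.P = Literature.Computability.Complexity.BPP :=
    Literature.Computability.Complexity.impagliazzo_wigderson_holds hE
  obtain ⟨L, hL, hLP⟩ := hX
  refine ⟨L, hL, ?_⟩
  rw [← hPBPP]
  exact hLP

/-- read-back: the composition applied to the stubs inhabits the crux (modulo the two sorries). -/
theorem YbTarget_of_stubs : YbTarget := YbTarget_of stub_eHard stub_notP

end Summit.QuantumAdvantage.QuantumAdvantage.Cruxes.YbTarget.DerandomizationSplit
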